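import Mathlib
import Literature.AlgebraicGeometry.Resolution.CobordantGame
import Literature.AlgebraicGeometry.Resolution.CobordantChartCoefficients
import Summits.ResolutionOfSingularities.ResolutionOfSingularities.Theorems.WeightedInvariantLocalWeightedDropGradedGame
import Summits.ResolutionOfSingularities.ResolutionOfSingularities.Theorems.WeightedInvariantLocalWeightedDropGradedGameSlice
import Summits.ResolutionOfSingularities.ResolutionOfSingularities.Theorems.WeightedInvariantLocalWeightedDropOrbitQuasiInvariance
/-!
# `WeightedInvariant.LocalWeightedDrop`: the graded-slice SPECIMEN — the wild successor of card A's umbrella is graded-won in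
# ONE move, and its slice carries a grading separating `y` from `s`, `Z`

Route `ResolutionOfSingularities/WeightedInvariant`, crux `LocalWeightedDrop` (stmt-ResolutionOfSingularities-8899).
[OURS · L1 W4.3] — CHAIN w43 SEAT TABLE v7 row res-type-060 «idea-1's graded slices»; first half of a kernel PROBE of R3-T3
`gradedWonBy_slice_iff` (ideator res-L1-w43-idea-1, Sketch-L1-idea-1.lean v3 `631198685223c190` §5: «the successor `g` at `c`
with `c_{i₀} ≠ 0 < w_{i₀}` is won in the graded game iff its `n`-variable slice is, WITH THE SAME RANK» — flagged CONJECTURAL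
there).  Companion modules: `…Theorems.GradedGame` (p498029: `GradedWonBy`, `succLattice`, …), `…GradedGameSlice`
(`sliceLattice`, `sliceGerm`), `…OrbitQuasiInvariance` (p500270: `hasSubst_cruxChart`).  The second
half (`WeightedInvariantLocalWeightedDropGradedSliceNoOneMoveWin`) proves that the slice has NO graded one-move win and assembles
the refutation of R3-T3 as typed.  Nothing here is a statement of the manuscript under review on ladder RESOLUTION; R3-T3 is
OURS (conjectural) and this probes its typing — not a verdict on card A.  AI proof, weaker than expert review.

**The specimen** (every field `k`, every prime `p`; characteristic `p` where marked): card A's umbrella `F = Z^p + x·y^p`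
(A0a), `L = ⊤`, `θ = id`, pointwise-lexmax weights `w = (p+1, p, p)`, the WILD exceptional point `c = (0, 1, 0)`
(`c_x = 1 ≠ 0 < w_x = p`), exponent `a = p(p+1)`:
* `isSuccessorAt_umbrella` — the `s`-saturated successor is `g = Z^p + (1 + x)·y^p ∈ k[[s, Z, x, y]]`;
* `sliceGerm_umbrella` — its slice at `i₀ = x` is `sliceGerm 1 g = Z^p + y^p ∈ k[[s, Z, y]]` (the term `x·y^p` that makes
  `g` a TWISTED rather than an honest cylinder dies on the slice);
* `gradedWonBy_zero_umbrella` — **`g` is graded-won with rank `0` for EVERY grading lattice** (`char k = p`): the identity move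
  with centre `{Z = y = 0}` (weights `(0,1,0,1)`; graded for every lattice, `isLGradedMove_X`) has NO singular successor — at an
  exceptional point `(c_Z, c_y) ≠ 0` the `s`-saturation is `(c_Z + Z')^p + (1 + x')(c_y + y')^p` (uniqueness of the
  `s`-saturation, `eq_of_X_pow_mul_eq`), with constant term `c_Z^p + c_y^p` and `x'`-coefficient `c_y^p`, not both zero;
* `intCast_sub_eq_zero_of_mem_succLattice_umbrella` / `…_sliceLattice_umbrella` — the propagated grading is the stabiliser
  `μ_p` of the wild point: `v ∈ succLattice ⊤ w c ⇒ v_s ≡ v_Z (mod p)`, also on `sliceLattice … 1`; hence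
  `single_zero/one_sub_single_two_notMem_sliceLattice_umbrella`: on the slice lattice the characters of `s`, `Z` both DIFFER
  from that of `y` — the slice `(Z + y)^p` is the `p`-th power of a smooth form which is NOT a semi-invariant.

Tools: `gradedWonBy_zero_iff`, `GradedWonBy.mono`, `eq_of_X_pow_mul_eq` (uniqueness of the `s`-saturation),
`expVec_single`, `isLGradedMove_X`, `cruxChart_of_pos` / `cruxChart_of_eq_zero` / `cruxChart_eq_chart_of_convention`.
-/

set_option linter.dupNamespace false -- mandated namespace of this single-conjunct summit
set_option autoImplicit false

namespace Summit.ResolutionOfSingularities.ResolutionOfSingularities.Theorems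

namespace GradedGame

open MvPowerSeries
open Literature.AlgebraicGeometry.Resolution
open Literature.AlgebraicGeometry.Resolution.CobordantChart (chart cruxChart_eq_chart)

variable {k : Type} [Field k]

/-! ## §1 Tools -/

/-- Graded rank `0`: some `L`-graded move has no singular successor at all (a one-move win in the graded game).
[OURS · L1 W4.3] -/
theorem gradedWonBy_zero_iff {m : ℕ} (L : AddSubgroup (Fin m → ℤ)) (f : MvPowerSeries (Fin m) k) :
    GradedWonBy 0 m L f ↔ ∃ (θ : Fin m → MvPowerSeries (Fin m) k) (w : Fin m → ℕ), IsLGradedMove L θ w ∧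
      ∀ (c : Fin m → k) (a : ℕ) (g : MvPowerSeries (Fin (m + 1)) k), ¬ IsSuccessorAt f θ w c a g := by
  rw [gradedWonBy_iff]
  refine exists_congr fun θ => exists_congr fun w => and_congr_right fun _ => ?_
  refine forall_congr' fun c => forall_congr' fun a => forall_congr' fun g => ⟨fun h hg => ?_, fun h hg => absurd hg h⟩
  obtain ⟨β, hβ, -⟩ := h hg
  exact not_lt_zero hβ

/-- Graded ranks are monotone. [OURS · L1 W4.3] -/
theorem GradedWonBy.mono {α α' : Ordinal.{0}} (hle : α ≤ α') {m : ℕ} {L : AddSubgroup (Fin m → ℤ)}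
    {f : MvPowerSeries (Fin m) k} (h : GradedWonBy α m L f) : GradedWonBy α' m L f := by
  rw [gradedWonBy_iff] at h ⊢
  obtain ⟨θ, w, hθ, hs⟩ := h
  refine ⟨θ, w, hθ, fun c a g hg => ?_⟩
  obtain ⟨β, hβ, hW⟩ := hs c a g hg
  exact ⟨β, lt_of_lt_of_le hβ hle, hW⟩

/-- UNIQUENESS OF THE `s`-SATURATION: `sᵃ·G = sᵇ·H`, `s ∤ G`, `s ∤ H` ⇒ `a = b ∧ G = H`. [OURS · L1 W4.3] -/
theorem eq_of_X_pow_mul_eq {m : ℕ} {G H : MvPowerSeries (Fin (m + 1)) k} {a b : ℕ}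
    (h : X 0 ^ a * G = X 0 ^ b * H) (hG : ¬ X 0 ∣ G) (hH : ¬ X 0 ∣ H) : a = b ∧ G = H := by
  have hX : (X (0 : Fin (m + 1)) : MvPowerSeries (Fin (m + 1)) k) ≠ 0 := X_zero_ne_zero
  have key : ∀ {G H : MvPowerSeries (Fin (m + 1)) k} {a b : ℕ}, a ≤ b →
      X 0 ^ a * G = X 0 ^ b * H → ¬ X 0 ∣ G → a = b ∧ G = H := by
    intro G H a b hab h hG
    obtain ⟨d, rfl⟩ := Nat.exists_eq_add_of_le hab
    rw [pow_add, mul_assoc] at h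
    have h' : G = X 0 ^ d * H := mul_left_cancel₀ (pow_ne_zero a hX) h
    cases d with
    | zero => exact ⟨by simp, by simpa using h'⟩
    | succ d => exact absurd ⟨X 0 ^ d * H, by rw [h', pow_succ]; ring⟩ hG
  rcases le_total a b with hab | hba
  · exact key hab h hG
  · obtain ⟨h1, h2⟩ := key hba h.symm hH
    exact ⟨h1.symm, h2.symm⟩

/-- `expVec` of a single exponent is the corresponding integer unit vector (scaled). [OURS · L1 W4.3] -/
theorem expVec_single {m : ℕ} (i : Fin m) (n : ℕ) : expVec (Finsupp.single i n) = Pi.single i (n : ℤ) := by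
  funext j
  by_cases hj : j = i
  · subst hj; simp [expVec]
  · simp [expVec, hj]

/-- THE IDENTITY COORDINATE CHANGE IS A GRADED MOVE (every lattice, every weight with a positive entry). [OURS · L1 W4.3] -/
theorem isLGradedMove_X {m : ℕ} (L : AddSubgroup (Fin m → ℤ)) (w : Fin m → ℕ) (hw : ∃ i, 0 < w i) :
    IsLGradedMove L (fun i => (X i : MvPowerSeries (Fin m) k)) w := by
  refine ⟨⟨fun i => constantCoeff_X i, ?_, hw⟩, ?_⟩
  · have h1 : (Matrix.of fun i j => coeff (Finsupp.single j 1) ((fun i => (X i : MvPowerSeries (Fin m) k)) i)) = 1 := by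
      ext i j
      rw [Matrix.of_apply, coeff_X, Matrix.one_apply]
      by_cases h : i = j
      · subst h; simp
      · rw [if_neg (fun hh => h ((Finsupp.single_left_inj one_ne_zero).mp hh).symm), if_neg h]
    rw [h1, Matrix.det_one]
    exact isUnit_one
  · intro i e he
    rw [coeff_X] at he
    have hei : e = Finsupp.single i 1 := by
      by_contra hne
      exact he (if_neg hne)
    subst hei
    rw [expVec_single, Nat.cast_one, sub_self]
    exact L.zero_mem

/-- The crux's chart at a positive weight. [OURS · L1 W4.3] -/
theorem cruxChart_of_pos {n : ℕ} (w : Fin n → ℕ) (c : Fin n → k) (i : Fin n) (h : 0 < w i) :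
    CobordantGame.cruxChart k w c i = X (0 : Fin (n + 1)) ^ (w i) * (C (c i) + X i.succ) :=
  if_pos h

/-- The crux's chart at a zero weight. [OURS · L1 W4.3] -/
theorem cruxChart_of_eq_zero {n : ℕ} (w : Fin n → ℕ) (c : Fin n → k) (i : Fin n) (h : w i = 0) :
    CobordantGame.cruxChart k w c i = X i.succ := by
  unfold CobordantGame.cruxChart
  rw [if_neg (by omega)]

/-- The crux's chart family is `CobordantChart.chart w c` once `c` follows the convention `cᵢ = 0` for `wᵢ = 0`.
[OURS · L1 W4.3] -/
theorem cruxChart_eq_chart_of_convention {n : ℕ} (w : Fin n → ℕ) (c : Fin n → k) (hc : ∀ i, w i = 0 → c i = 0) :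
    CobordantGame.cruxChart k w c = chart w c := by
  have h := cruxChart_eq_chart (k := k) w c
  have hc' : (fun i => if 0 < w i then c i else 0) = c := by
    funext i
    by_cases hw : 0 < w i
    · rw [if_pos hw]
    · rw [if_neg hw]; exact (hc i (by omega)).symm
  rw [hc'] at h
  exact h

/-! ## §2 The umbrella successor `g = Z^p + (1 + x)·y^p` and its slice `h = Z^p + y^p` -/

section Umbrella

variable (p : ℕ) [hp : Fact p.Prime]

omit hp in
/-- Monomial normal form of the specimen `g = Z^p + (1 + x)·y^p = Z^p + y^p + x·y^p`. [OURS · L1 W4.3] -/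
theorem umbrella_eq_monomial :
    (X 1 ^ p + (1 + X 2) * X 3 ^ p : MvPowerSeries (Fin 4) k) =
      monomial (Finsupp.single 1 p) 1 + monomial (Finsupp.single 3 p) 1 +
        monomial (Finsupp.single 2 1 + Finsupp.single 3 p) 1 := by
  rw [X_pow_eq, X_pow_eq, X_def, add_mul, one_mul, monomial_mul_monomial, one_mul, add_assoc]

omit hp in
/-- Monomial normal form of the slice `h = Z^p + y^p`. [OURS · L1 W4.3] -/
theorem addPow_eq_monomial :
    (X 1 ^ p + X 2 ^ p : MvPowerSeries (Fin 3) k) = monomial (Finsupp.single 1 p) 1 + monomial (Finsupp.single 2 p) 1 := by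
  rw [X_pow_eq, X_pow_eq]

/-- No degree-one exponent of `k[[s, Z, x, y]]` is the exponent of `x·y^p` (`p ≥ 2`). [OURS · L1 W4.3] -/
theorem single_one_ne_mixed (j : Fin 4) :
    (Finsupp.single j 1 : Fin 4 →₀ ℕ) ≠ Finsupp.single 2 1 + Finsupp.single 3 p := by
  have hp2 : 2 ≤ p := hp.out.two_le
  intro h
  have h3 := DFunLike.congr_fun h 3
  simp only [Finsupp.single_apply, Finsupp.coe_add, Pi.add_apply] at h3
  split_ifs at h3 <;> omega

/-- The exponent of `Z^p` (or of `y^p`) is not the exponent of `x·y^p`. [OURS · L1 W4.3] -/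
theorem single_pow_ne_mixed (j : Fin 4) (hj : j ≠ 3) :
    (Finsupp.single j p : Fin 4 →₀ ℕ) ≠ Finsupp.single 2 1 + Finsupp.single 3 p := by
  have hp0 : p ≠ 0 := hp.out.ne_zero
  intro h
  have h3 := DFunLike.congr_fun h 3
  simp only [Finsupp.single_apply, Finsupp.coe_add, Pi.add_apply] at h3
  split_ifs at h3 <;> omega

/-- THE SPECIMEN IS A GENUINE POSITION OF THE GRADED GAME (every field, every prime `p`): from the umbrella start
`F = Z^p + x·y^p ∈ k[[Z, x, y]]` (card A's A0a, idea-1 Sketch v3 §2), the identity coordinate change and the pointwise-lexmax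
weights `w = (p+1, p, p)`, the exceptional point `c = (0, 1, 0)` (OFF the vertex, `c_x = 1 ≠ 0 < w_x = p`: a WILD point) has the
`s`-saturated successor `g = Z^p + (1 + x)·y^p ∈ k[[s, Z, x, y]]` with exponent `a = p·(p+1)`:
`IsSuccessorAt F X w c (p(p+1)) g`. [OURS · L1 W4.3] -/
theorem isSuccessorAt_umbrella :
    IsSuccessorAt (X 0 ^ p + X 1 * X 2 ^ p : MvPowerSeries (Fin 3) k) (fun i => X i) ![p + 1, p, p] ![(0 : k), 1, 0]
      (p * (p + 1)) (X 1 ^ p + (1 + X 2) * X 3 ^ p : MvPowerSeries (Fin 4) k) := by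
  have hp0 : 0 < p := hp.out.pos
  have hX : HasSubst (fun i : Fin 3 => (X i : MvPowerSeries (Fin 3) k)) := hasSubst_of_constantCoeff_zero fun i => constantCoeff_X i
  have hC := hasSubst_cruxChart (k := k) ![p + 1, p, p] ![(0 : k), 1, 0]
  refine ⟨⟨1, by simp [hp0], by simp⟩, ?_, ?_, ?_, ?_⟩
  · -- the chart computation
    have hself : subst (fun i : Fin 3 => (X i : MvPowerSeries (Fin 3) k)) (X 0 ^ p + X 1 * X 2 ^ p : MvPowerSeries (Fin 3) k) =
        (X 0 ^ p + X 1 * X 2 ^ p : MvPowerSeries (Fin 3) k) := by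
      rw [show (fun i : Fin 3 => (X i : MvPowerSeries (Fin 3) k)) = X from rfl, subst_self]; rfl
    rw [hself, subst_add hC, subst_mul hC, subst_pow hC, subst_pow hC, subst_X hC, subst_X hC, subst_X hC,
      cruxChart_of_pos _ _ 0 (by simp), cruxChart_of_pos _ _ 1 (by simp [hp0]), cruxChart_of_pos _ _ 2 (by simp [hp0])]
    simp only [Matrix.cons_val_zero, Matrix.cons_val_one, Matrix.head_cons, Matrix.cons_val_two, Matrix.tail_cons,
      map_zero, map_one, zero_add, Fin.succ_zero_eq_one]
    have h1 : (1 : Fin 3).succ = (2 : Fin 4) := rfl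
    have h2 : (2 : Fin 3).succ = (3 : Fin 4) := rfl
    rw [h1, h2]
    ring
  · -- `s ∤ g`: the monomial `Z^p` survives
    rw [X_dvd_iff]
    push Not
    refine ⟨Finsupp.single 1 p, by simp, ?_⟩
    rw [umbrella_eq_monomial, map_add, map_add, coeff_monomial, coeff_monomial, coeff_monomial, if_pos rfl,
      if_neg (by simp [Finsupp.single_eq_single_iff, hp0.ne']), if_neg (single_pow_ne_mixed p 1 (by decide))]
    simp
  · simp [map_add, map_mul, map_pow, constantCoeff_X, zero_pow hp0.ne']
  · intro j
    have hp1 : p ≠ 1 := hp.out.one_lt.ne'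
    rw [umbrella_eq_monomial, map_add, map_add, coeff_monomial, coeff_monomial, coeff_monomial,
      if_neg (single_one_ne_mixed p j), if_neg, if_neg, add_zero, add_zero]
    · simp [Finsupp.single_eq_single_iff, hp1.symm]
    · simp [Finsupp.single_eq_single_iff, hp1.symm]

omit hp in
/-- THE SLICE OF THE SPECIMEN: freezing the translated coordinate `x` (`i₀ = 1`), `sliceGerm 1 g = Z^p + y^p ∈ k[[s, Z, y]]` —
the `p`-th power of the smooth form `Z + y` in characteristic `p` (the term `x·y^p` that distinguishes the twisted cylinder `g`
from an honest cylinder dies on the slice). [OURS · L1 W4.3] -/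
theorem sliceGerm_umbrella :
    sliceGerm 1 (X 1 ^ p + (1 + X 2) * X 3 ^ p : MvPowerSeries (Fin 4) k) = (X 1 ^ p + X 2 ^ p : MvPowerSeries (Fin 3) k) := by
  ext e
  rw [coeff_sliceGerm, umbrella_eq_monomial, addPow_eq_monomial]
  simp only [map_add, coeff_monomial]
  set f : Fin 3 ↪ Fin 4 := ⟨(1 : Fin 3).succ.succAbove, Fin.succAbove_right_injective⟩ with hf
  have hf1 : f 1 = 1 := by decide
  have hf2 : f 2 = 3 := by decide
  have e1 : (Finsupp.single (1 : Fin 4) p : Fin 4 →₀ ℕ) = Finsupp.embDomain f (Finsupp.single 1 p) := by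
    rw [Finsupp.embDomain_single, hf1]
  have e3 : (Finsupp.single (3 : Fin 4) p : Fin 4 →₀ ℕ) = Finsupp.embDomain f (Finsupp.single 2 p) := by
    rw [Finsupp.embDomain_single, hf2]
  have hmix : Finsupp.embDomain f e ≠ Finsupp.single 2 1 + Finsupp.single 3 p := by
    intro h
    have h2 := DFunLike.congr_fun h 2
    rw [Finsupp.embDomain_notin_range] at h2
    · simp at h2
    · rintro ⟨j, hj⟩
      exact Fin.succAbove_ne _ j hj
  have i1 : Finsupp.embDomain f e = Finsupp.single 1 p ↔ e = Finsupp.single 1 p := by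
    rw [e1, (Finsupp.embDomain_injective f).eq_iff]
  have i3 : Finsupp.embDomain f e = Finsupp.single 3 p ↔ e = Finsupp.single 2 p := by
    rw [e3, (Finsupp.embDomain_injective f).eq_iff]
  rw [if_neg hmix, add_zero]
  simp only [i1, i3]

/-- No exponent `single j n` of `k[[σ, s, Z, x, y]]` with `j ≠ y` is the exponent of `x·y^p`. [OURS · L1 W4.3] -/
theorem single_ne_mixed_of_ne {j : Fin 5} (hj : j ≠ 4) (n : ℕ) :
    (Finsupp.single j n : Fin 5 →₀ ℕ) ≠ Finsupp.single 3 1 + Finsupp.single 4 p := by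
  have hp0 : p ≠ 0 := hp.out.ne_zero
  intro h
  have h4 := DFunLike.congr_fun h 4
  rw [Finsupp.add_apply, Finsupp.single_apply, Finsupp.single_apply, Finsupp.single_apply, if_neg hj,
    if_neg (show (3 : Fin 5) ≠ 4 by decide), if_pos rfl] at h4
  omega

/-- THE SPECIMEN IS GRADED-WON WITH RANK `0`, for EVERY grading lattice: the identity move with weights `(0,1,0,1)` (centre
`{Z = y = 0}` = the singular locus of `g`, an `L`-graded move for every `L`) has NO singular successor — at an exceptional point
`(c_Z, c_y) ≠ 0` the `s`-saturated successor is `(c_Z + Z)^p + (1 + x)(c_y + y)^p`, with constant term `c_Z^p + c_y^p` and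
`x`-coefficient `c_y^p`, not both zero. [OURS · L1 W4.3] -/
theorem gradedWonBy_zero_umbrella [CharP k p] (L : AddSubgroup (Fin 4 → ℤ)) :
    GradedWonBy 0 4 L (X 1 ^ p + (1 + X 2) * X 3 ^ p : MvPowerSeries (Fin 4) k) := by
  have hp0 : 0 < p := hp.out.pos
  have hp1 : p ≠ 1 := hp.out.one_lt.ne'
  haveI : CharP (MvPowerSeries (Fin 5) k) p := charP_of_injective_ringHom MvPowerSeries.C_injective p
  rw [gradedWonBy_zero_iff]
  refine ⟨fun i => X i, ![0, 1, 0, 1], isLGradedMove_X L _ ⟨1, by simp⟩, ?_⟩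
  rintro c a g ⟨⟨i, hwi, hci⟩, hfac, hndvd, hc0, hc1⟩
  have hC := hasSubst_cruxChart (k := k) ![0, 1, 0, 1] c
  -- the chart computation: `g(chart_c) = σ^p · G`
  set G : MvPowerSeries (Fin 5) k := (C (c 1) + X 2) ^ p + (1 + X 3) * (C (c 3) + X 4) ^ p with hG
  have hself : subst (fun i : Fin 4 => (X i : MvPowerSeries (Fin 4) k))
      (X 1 ^ p + (1 + X 2) * X 3 ^ p : MvPowerSeries (Fin 4) k) = (X 1 ^ p + (1 + X 2) * X 3 ^ p : MvPowerSeries (Fin 4) k) := by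
    rw [show (fun i : Fin 4 => (X i : MvPowerSeries (Fin 4) k)) = X from rfl, subst_self]; rfl
  have hg' : (X 1 ^ p + (1 + X 2) * X 3 ^ p : MvPowerSeries (Fin 4) k) = X 1 ^ p + X 3 ^ p + X 2 * X 3 ^ p := by ring
  have hchart : subst (CobordantGame.cruxChart k ![0, 1, 0, 1] c) (subst (fun i : Fin 4 => (X i : MvPowerSeries (Fin 4) k))
      (X 1 ^ p + (1 + X 2) * X 3 ^ p : MvPowerSeries (Fin 4) k)) = X 0 ^ p * G := by
    rw [hself, hg', subst_add hC, subst_add hC, subst_mul hC, subst_pow hC, subst_pow hC, subst_X hC, subst_X hC, subst_X hC,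
      cruxChart_of_pos _ _ 1 (by simp), cruxChart_of_eq_zero _ _ 2 (by simp), cruxChart_of_pos _ _ 3 (by simp)]
    simp only [Matrix.cons_val_one, Matrix.head_cons, Matrix.cons_val_zero, Matrix.cons_val_three, Matrix.tail_cons,
      pow_one]
    have h1 : (1 : Fin 4).succ = (2 : Fin 5) := rfl
    have h2 : (2 : Fin 4).succ = (3 : Fin 5) := rfl
    have h3 : (3 : Fin 4).succ = (4 : Fin 5) := rfl
    rw [h1, h2, h3, hG]
    simp only [mul_pow]
    ring
  rw [hchart] at hfac
  -- monomial normal form of `G` in characteristic `p`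
  have hmul : (monomial (Finsupp.single 3 1) (1 : k) : MvPowerSeries (Fin 5) k) * monomial (Finsupp.single 4 p) 1 =
      monomial (Finsupp.single 3 1 + Finsupp.single 4 p) 1 := by
    rw [monomial_mul_monomial, one_mul]
  have hGexp : G = C (c 1 ^ p) + monomial (Finsupp.single 2 p) 1 + (C (c 3 ^ p) + monomial (Finsupp.single 4 p) 1) +
      (C (c 3 ^ p) * monomial (Finsupp.single 3 1) 1 + monomial (Finsupp.single 3 1 + Finsupp.single 4 p) 1) := by
    rw [hG, add_pow_char, add_pow_char, ← map_pow, ← map_pow, X_pow_eq, X_pow_eq, X_def, ← hmul]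
    ring
  have h20 : (Finsupp.single 2 p : Fin 5 →₀ ℕ) ≠ 0 := by simp [hp0.ne']
  have h24 : (Finsupp.single 2 p : Fin 5 →₀ ℕ) ≠ Finsupp.single 4 p := by simp [Finsupp.single_eq_single_iff, hp0.ne']
  have h23 : (Finsupp.single 2 p : Fin 5 →₀ ℕ) ≠ Finsupp.single 3 1 := by simp [Finsupp.single_eq_single_iff, hp0.ne']
  have hm2 := single_ne_mixed_of_ne p (show (2 : Fin 5) ≠ 4 by decide) p
  have hG2 : coeff (Finsupp.single 2 p) G = 1 := by
    rw [hGexp]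
    simp only [map_add, coeff_C, coeff_monomial, coeff_C_mul, h20, h24, h23, hm2, if_false, if_true]
    ring
  have hG0 : constantCoeff G = c 1 ^ p + c 3 ^ p := by
    simp [hG, map_add, map_mul, map_pow, constantCoeff_X, constantCoeff_C]
  have h30 : (Finsupp.single 3 1 : Fin 5 →₀ ℕ) ≠ 0 := by simp
  have h32 : (Finsupp.single 3 1 : Fin 5 →₀ ℕ) ≠ Finsupp.single 2 p := by simp [Finsupp.single_eq_single_iff, hp1.symm]
  have h34 : (Finsupp.single 3 1 : Fin 5 →₀ ℕ) ≠ Finsupp.single 4 p := by simp [Finsupp.single_eq_single_iff, hp1.symm]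
  have hm3 := single_ne_mixed_of_ne p (show (3 : Fin 5) ≠ 4 by decide) 1
  have hG3 : coeff (Finsupp.single 3 1) G = c 3 ^ p := by
    rw [hGexp]
    simp only [map_add, coeff_C, coeff_monomial, coeff_C_mul, h30, h32, h34, hm3, if_false, if_true]
    ring
  -- `σ ∤ G`, so `G` IS the `s`-saturated successor
  have hGnd : ¬ X 0 ∣ G := by
    rw [X_dvd_iff]
    push Not
    exact ⟨Finsupp.single 2 p, by simp, by rw [hG2]; exact one_ne_zero⟩
  obtain ⟨-, hGg⟩ := eq_of_X_pow_mul_eq hfac hGnd hndvd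
  rw [← hGg] at hc0 hc1
  have h3 : c 3 = 0 := by
    have h := hc1 3
    rw [hG3] at h
    exact (pow_eq_zero_iff hp0.ne').mp h
  have h1 : c 1 = 0 := by
    rw [hG0, h3, zero_pow hp0.ne', add_zero] at hc0
    exact (pow_eq_zero_iff hp0.ne').mp hc0
  -- … contradicting that the exceptional point is off the vertex
  fin_cases i <;> simp_all

/-- THE GRADING OF THE SPECIMEN: every character vector `v` in the successor lattice `succLattice ⊤ (p+1,p,p) (0,1,0)` has
`v_s ≡ v_Z (mod p)` (the stabiliser `μ_p` of the wild point acts on `s` and `Z` with opposite non-trivial characters and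
trivially on `x`, `y`). [OURS · L1 W4.3] -/
theorem intCast_sub_eq_zero_of_mem_succLattice_umbrella (v : Fin 4 → ℤ)
    (hv : v ∈ succLattice (⊤ : AddSubgroup (Fin 3 → ℤ)) ![p + 1, p, p] ![(0 : k), 1, 0]) :
    ((v 0 - v 1 : ℤ) : ZMod p) = 0 := by
  let φ : (Fin 4 → ℤ) →+ ZMod p :=
    { toFun := fun v => ((v 0 - v 1 : ℤ) : ZMod p)
      map_zero' := by simp
      map_add' := fun u v => by simp only [Pi.add_apply]; push_cast; ring }
  have hle : succLattice (⊤ : AddSubgroup (Fin 3 → ℤ)) ![p + 1, p, p] ![(0 : k), 1, 0] ≤ φ.ker := by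
    unfold succLattice
    rw [AddSubgroup.closure_le]
    rintro u (⟨r, -, rfl⟩ | ⟨j, hcj, -, rfl⟩)
    · rw [SetLike.mem_coe, AddMonoidHom.mem_ker]
      show (((Matrix.vecCons (∑ j, ((![p + 1, p, p] : Fin 3 → ℕ) j : ℤ) * r j) r) 0 -
          (Matrix.vecCons (∑ j, ((![p + 1, p, p] : Fin 3 → ℕ) j : ℤ) * r j) r) 1 : ℤ) : ZMod p) = 0
      simp only [Matrix.cons_val_zero, Matrix.cons_val_one, Matrix.head_cons, Fin.sum_univ_three,
        Matrix.cons_val_two, Matrix.tail_cons]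
      push_cast
      have hpz : (p : ZMod p) = 0 := ZMod.natCast_self p
      linear_combination (r 0 + r 1 + r 2) * hpz
    · rw [SetLike.mem_coe, AddMonoidHom.mem_ker]
      have hj : j = 1 := by
        fin_cases j <;> simp at hcj ⊢
      subst hj
      show (((Pi.single ((1 : Fin 3).succ) (1 : ℤ) : Fin 4 → ℤ) 0 - (Pi.single ((1 : Fin 3).succ) (1 : ℤ) : Fin 4 → ℤ) 1 : ℤ) :
          ZMod p) = 0
      simp
  have := (AddMonoidHom.mem_ker).mp (hle hv)
  exact this

/-- … hence the same congruence `u_s ≡ u_Z (mod p)` on the slice lattice at `i₀ = 1` (`x` frozen). [OURS · L1 W4.3] -/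
theorem intCast_sub_eq_zero_of_mem_sliceLattice_umbrella (u : Fin 3 → ℤ)
    (hu : u ∈ sliceLattice (succLattice (⊤ : AddSubgroup (Fin 3 → ℤ)) ![p + 1, p, p] ![(0 : k), 1, 0]) 1) :
    ((u 0 - u 1 : ℤ) : ZMod p) = 0 := by
  rw [mem_sliceLattice_iff] at hu
  obtain ⟨v, hv, rfl⟩ := hu
  exact intCast_sub_eq_zero_of_mem_succLattice_umbrella p v hv

/-- On the slice lattice the characters of `s` and of `y` DIFFER. [OURS · L1 W4.3] -/
theorem single_zero_sub_single_two_notMem_sliceLattice_umbrella :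
    (Pi.single 0 1 - Pi.single 2 1 : Fin 3 → ℤ) ∉
      sliceLattice (succLattice (⊤ : AddSubgroup (Fin 3 → ℤ)) ![p + 1, p, p] ![(0 : k), 1, 0]) 1 := by
  intro h
  have := intCast_sub_eq_zero_of_mem_sliceLattice_umbrella p _ h
  simp at this

/-- On the slice lattice the characters of `Z` and of `y` DIFFER. [OURS · L1 W4.3] -/
theorem single_one_sub_single_two_notMem_sliceLattice_umbrella :
    (Pi.single 1 1 - Pi.single 2 1 : Fin 3 → ℤ) ∉
      sliceLattice (succLattice (⊤ : AddSubgroup (Fin 3 → ℤ)) ![p + 1, p, p] ![(0 : k), 1, 0]) 1 := by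
  intro h
  have := intCast_sub_eq_zero_of_mem_sliceLattice_umbrella p _ h
  simp at this


end Umbrella

end GradedGame

end Summit.ResolutionOfSingularities.ResolutionOfSingularities.Theorems
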